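import Literature.NumberTheory.Sieve.IwaniecAlmostPrimesLemma4
import HarnessLib

/-!
# Iwaniec (1978), §4: the linear model of the window counts, and the evaluation of `U` — PROVED

H. Iwaniec, *Almost-primes represented by quadratic polynomials*, Invent. Math. **47** (1978)
171–188, §4 (pp. 179–182).  Fifth file of the inline proof of Proposition 1
(`Literature.NumberTheory.Sieve.Iwaniec1978.proposition1`): it packages Lemma 4
(`lemma4_window`, relative form), the total count (`card_lemma4Family_eq`) and the mean value of
`ρ` (`abs_rhoSumAP_sub_le`) into the one statement the evaluations of `V` and `W` consume — the
window counts are linear in the length of the `m`-range, with the common density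
`κ = (φ(Q)/Q) S_Q(G) Λ_Q(E)` (divided by `φ(d)` on a class mod `d`) — and evaluates `U` by the
same mean value.  Everything is PROVED from `lemma6_hooley` (discharged in
`IwaniecAlmostPrimesProofs.lean`); no named facts.

* `kappa Q G E` (`|κ| ≤ 2E`), `totient_div_mul_totient` (`φ(Q/d) φ(d) = φ(Q)`, `Q` squarefree),
  `window_iff_div_eq` (`c/q ≤ Θ/(mq) < (c+1)/q ⇔ ⌊Θ/m⌋ = c`), `windowCount` (`P_c(A, t)`);
* `windowCount_linear` — **the linear model**: for `ε > 0` there is `C ≥ 0` with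
  `|P_c(A,t) − (1/q) ρ(q/d) (κ/φ(d)) (t − A)| ≤ windowErr`, where
  `windowErr = 4ρ(q/d) Σ₀(t)/A^{1/4} + C d (∑_{l∣Q} ρ(lq)) (1 + log 16A)² S^{1/2+ε} S
   + (2/q) ρ(q/d)(2τ(Q)+7)(√t √E + t/E)` (`S = ⌊√(tq)⌋`), for `Q` squarefree, `q ∣ Q`,
  `d ∣ q` odd, `(μ,d) = 1`, `d ∣ ω²+1`, `2 ≤ A ≤ t`, `c < q`, `1 ≤ E ≤ A`, `⌊√t⌋ ≤ G`
  (this is the corrected Lemma 4 with the right main term: Iwaniec's `(qM)^{3/4+ε}` error, the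
  extra `d` and the `4P/A^{1/4}` of the Fejér form being affordable downstream);
* `abs_sum_Ioc_mul_sub_le` (discrete Abel summation against a linear model),
  `windowFibre`, `sum_window_family_eq`, `windowErr`, `windowErr_mono`,
  `windowSum_inv_linear` — the same with the weight `1/m`:
  `|∑_{window} 1/m − (1/q)ρ(q/d)(κ/φ(d)) ∑_{A<m≤t} 1/m| ≤ windowErr/(A+1)` (p. 182, `S₀(M₁)`);
* `usum_linear` — **`U`**: `|∑_{A<m≤B,(m,Q)=1} ρ(m)/m² − κ ∑_{A<m≤B} 1/m²| ≤ 2(2τ(Q)+7)(√B√E + B/E)/(A+1)²`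
  (p. 181, (12); the main term is kept as the finite sum `κ ∑ 1/m²`, against which `V` and `W`
  cancel exactly).

## References

* H. Iwaniec, Invent. Math. 47 (1978) 171–188, §4, Lemma 4 and (12)–(14) (`IwaniecInventiones1978`).
-/

noncomputable section

open Finset Real

namespace Literature.NumberTheory.Sieve.Iwaniec1978

/-! ### The density `κ` and the window in integer form -/

/-- The common main-term density of `U, V, W`:
`κ = (φ(Q)/Q) · S_Q(G) · Λ_Q(E)` (truncated singular series times truncated `L`-value, see
`IwaniecAlmostPrimesRhoMeanValue.lean`); the mean value of `ρ` over `m ≡ μ (mod d)`, `(m, Q) = 1`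
is `(κ/φ(d)) · length`. [cite: IwaniecInventiones1978, Lemma 4] -/
def kappa (Q G E : ℕ) : ℝ := (Nat.totient Q : ℝ) / Q * sqfSeries Q G * chiSeries Q E

/-- `|κ| ≤ 2 (1 + log E)`-type crude bound: `|κ| ≤ 2 · ∑_{b ≤ E} 1/b`; here the cruder
`|κ| ≤ 2 E`. [folklore] -/
theorem abs_kappa_le (Q G E : ℕ) : |kappa Q G E| ≤ 2 * E := by
  unfold kappa
  rw [abs_mul, abs_mul]
  have h1 : |(Nat.totient Q : ℝ) / Q| ≤ 1 := by
    rcases Nat.eq_zero_or_pos Q with hQ | hQ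
    · subst hQ; simp
    · rw [abs_of_nonneg (by positivity), div_le_one (by exact_mod_cast hQ)]
      exact_mod_cast Nat.totient_le Q
  have h2 := abs_sqfSeries_le Q G
  have h3 : |chiSeries Q E| ≤ E := by
    unfold chiSeries
    refine (Finset.abs_sum_le_sum_abs _ _).trans ?_
    calc ∑ b ∈ (Ioc 0 E).filter (fun b => b.Coprime Q), |FriedlanderIwaniecPrimes.chi4R b / b|
        ≤ ∑ b ∈ (Ioc 0 E).filter (fun b => b.Coprime Q), (1 : ℝ) := by
          refine Finset.sum_le_sum fun b hb => ?_
          rw [Finset.mem_filter, Finset.mem_Ioc] at hb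
          rw [abs_div, abs_of_pos (by exact_mod_cast hb.1.1 : (0 : ℝ) < b)]
          rw [div_le_one (by exact_mod_cast hb.1.1)]
          have := FriedlanderIwaniecPrimes.abs_chi4R_le_one b
          have hb1 : (1 : ℝ) ≤ b := by exact_mod_cast hb.1.1
          linarith
      _ ≤ ∑ b ∈ Ioc 0 E, (1 : ℝ) :=
          Finset.sum_le_sum_of_subset_of_nonneg (Finset.filter_subset _ _) fun _ _ _ => zero_le_one
      _ = E := by simp
  calc |(Nat.totient Q : ℝ) / Q| * |sqfSeries Q G| * |chiSeries Q E| ≤ 1 * 2 * E := by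
        refine mul_le_mul (mul_le_mul h1 h2 (abs_nonneg _) zero_le_one) h3 (abs_nonneg _) (by norm_num)
    _ = 2 * E := by ring

/-- For squarefree `Q` and `d ∣ Q`: `φ(Q/d) φ(d) = φ(Q)`. [folklore] -/
theorem totient_div_mul_totient {Q d : ℕ} (hQ : Squarefree Q) (hdQ : d ∣ Q) :
    Nat.totient (Q / d) * Nat.totient d = Nat.totient Q := by
  have hQ0 : Q ≠ 0 := hQ.ne_zero
  have heq : Q / d * d = Q := Nat.div_mul_cancel hdQ
  have hcop : (Q / d).Coprime d := by
    have := hQ; rw [← heq, Nat.squarefree_mul_iff] at this; exact this.1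
  rw [← Nat.totient_mul hcop, heq]

/-- The window `⌊Θ/m⌋ = c` in terms of the fraction `Θ/(mq)`:
`c/q ≤ Θ/(mq) < (c+1)/q ⇔ ⌊Θ/m⌋ = c` (`m, q ≥ 1`). [folklore] -/
theorem window_iff_div_eq {m q Θ c : ℕ} (hm : 0 < m) (hq : 0 < q) :
    ((c : ℝ) / q ≤ (Θ : ℝ) / (m * q) ∧ (Θ : ℝ) / (m * q) < ((c : ℝ) + 1) / q) ↔ Θ / m = c := by
  have hm' : (0 : ℝ) < m := by exact_mod_cast hm
  have hq' : (0 : ℝ) < q := by exact_mod_cast hq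
  have h1 : (c : ℝ) / q ≤ (Θ : ℝ) / (m * q) ↔ c * m ≤ Θ := by
    rw [div_le_div_iff₀ hq' (by positivity)]
    constructor
    · intro h
      have : (c : ℝ) * m ≤ Θ := by nlinarith
      exact_mod_cast this
    · intro h
      have : (c : ℝ) * m ≤ Θ := by exact_mod_cast h
      nlinarith
  have h2 : (Θ : ℝ) / (m * q) < ((c : ℝ) + 1) / q ↔ Θ < (c + 1) * m := by
    rw [div_lt_div_iff₀ (by positivity) hq']
    constructor
    · intro h
      have : (Θ : ℝ) < ((c : ℝ) + 1) * m := by nlinarith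
      exact_mod_cast this
    · intro h
      have : (Θ : ℝ) < ((c + 1 : ℕ) : ℝ) * m := by exact_mod_cast h
      push_cast at this
      nlinarith
  rw [h1, h2]
  constructor
  · rintro ⟨ha, hb⟩
    exact Nat.div_eq_of_lt_le ha hb
  · intro h
    subst h
    refine ⟨Nat.div_mul_le_self Θ m, ?_⟩
    have := Nat.lt_mul_div_succ Θ hm
    rw [mul_comm] at this
    exact this

/-! ### The linear model of the window counts -/

/-- The count of Lemma 4 in integer form:
`P_c(A, t) = #{(m, Θ) ∈ lemma4Family q Q d μ ω A t : ⌊Θ/m⌋ = c}`.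
[cite: IwaniecInventiones1978, Lemma 4] -/
def windowCount (q Q d μ ω A t c : ℕ) : ℕ :=
  ((lemma4Family q Q d μ ω A t).filter (fun p : ℕ × ℕ => p.2 / p.1 = c)).card

/-- **The window count with its linear model** (Lemma 4 + the total count + the mean value of
`ρ`): assuming `lemma6_hooley`, for `ε > 0` there is `C ≥ 0` such that for `Q` squarefree,
`q ∣ Q`, `d ∣ q` odd, `(μ, d) = 1`, `d ∣ ω² + 1`, `2 ≤ A ≤ t ≤ 3A`, `c < q`, `1 ≤ E ≤ A`,
`⌊√t⌋ ≤ G`: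
`|P_c(A, t) − (1/q) ρ(q/d) (κ/φ(d)) (t − A)| ≤ 4ρ(q/d) Σ₀(t)/A^{1/4}
   + C d (∑_{l∣Q} ρ(lq)) (1 + log 16A)² S^{1/2+ε} S + (2/q) ρ(q/d) (2τ(Q) + 7)(√t √E + t/E)`,
`S = ⌊√(tq)⌋`, `Σ₀(t) = rhoSumAP t Q d μ`, `κ = kappa Q G E`.
[cite: IwaniecInventiones1978, Lemma 4] -/
theorem windowCount_linear (h6 : lemma6_hooley) {ε : ℝ} (hε : 0 < ε) :
    ∃ C : ℝ, 0 ≤ C ∧ ∀ (q Q d μ ω A t c E G : ℕ), Squarefree Q → q ∣ Q → d ∣ q → d % 2 = 1 →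
      μ.Coprime d → d ∣ ω ^ 2 + 1 → 2 ≤ A → A ≤ t → c < q → 1 ≤ E → E ≤ A → Nat.sqrt t ≤ G →
      |(windowCount q Q d μ ω A t c : ℝ) -
          1 / q * (rho (q / d) : ℝ) * (kappa Q G E / Nat.totient d) * ((t : ℝ) - A)| ≤
        4 * (rho (q / d) : ℝ) * (rhoSumAP t Q d μ : ℝ) / (A : ℝ) ^ (1 / 4 : ℝ) +
          C * d * (∑ l ∈ Q.divisors, (rho (l * q) : ℝ)) * (1 + Real.log (16 * A)) ^ 2 *
            ((Nat.sqrt (t * q) : ℝ) ^ (1 / 2 + ε) * Nat.sqrt (t * q)) +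
          2 / q * (rho (q / d) : ℝ) * ((2 * Q.divisors.card + 7) * (Real.sqrt t * Real.sqrt E + t / E)) := by
  obtain ⟨C, hC0, hC⟩ := lemma4_window h6 hε
  refine ⟨C, hC0, ?_⟩
  intro q Q d μ ω A t c E G hQ hqQ hdq hd2 hμ hω hA hAt hcq hE hEA hG
  have hQ0 : Q ≠ 0 := hQ.ne_zero
  have hq : 0 < q := Nat.pos_of_dvd_of_pos hqQ (Nat.pos_of_ne_zero hQ0)
  have hd : 0 < d := Nat.pos_of_dvd_of_pos hdq hq
  have hdQ : d ∣ Q := hdq.trans hqQ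
  have hq' : (0 : ℝ) < q := by exact_mod_cast hq
  have hA0 : (0 : ℝ) < A := by exact_mod_cast (by omega : 0 < A)
  set fam := lemma4Family q Q d μ ω A t with hfam
  -- the window as a condition on the fraction
  set α : ℝ := (c : ℝ) / q with hα
  set β : ℝ := ((c : ℝ) + 1) / q with hβ
  have hα0 : 0 ≤ α := by rw [hα]; positivity
  have hαβ : α ≤ β := by rw [hα, hβ]; gcongr; linarith
  have hβ1 : β ≤ 1 := by
    rw [hβ, div_le_one hq']
    have : c + 1 ≤ q := hcq
    exact_mod_cast this
  have hβα : β - α = 1 / q := by rw [hα, hβ]; field_simp; ring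
  have hwin : (windowCount q Q d μ ω A t c : ℝ) =
      ((fam.filter (fun p : ℕ × ℕ => α ≤ (p.2 : ℝ) / (p.1 * q) ∧ (p.2 : ℝ) / (p.1 * q) < β)).card : ℝ) := by
    unfold windowCount
    congr 2
    refine Finset.filter_congr fun p hp => ?_
    rw [mem_lemma4Family] at hp
    have hm : 0 < p.1 := by omega
    rw [hα, hβ, window_iff_div_eq hm hq]
  -- Lemma 4
  have h4 := hC q Q d μ ω A t α β hQ0 hq hdq hA hα0 hαβ hβ1
  rw [hβα] at h4
  -- the total count and the mean value
  have hcard := card_lemma4Family_eq (μ := μ) hQ hqQ hdq hω hAt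
  have hEt : E ≤ t := hEA.trans hAt
  have hGA : Nat.sqrt A ≤ G := (Nat.sqrt_le_sqrt hAt).trans hG
  have hmt := abs_rhoSumAP_sub_le (Y := t) hQ hdQ hd2 hμ hE hEt hG
  have hmA := abs_rhoSumAP_sub_le (Y := A) hQ hdQ hd2 hμ hE hEA hGA
  -- the density in terms of `κ/φ(d)`
  have hdens : (Nat.totient (Q / d) : ℝ) / Q * sqfSeries Q G * chiSeries Q E =
      kappa Q G E / Nat.totient d := by
    have hφd : (0 : ℝ) < Nat.totient d := by exact_mod_cast Nat.totient_pos.mpr hd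
    have hmul := totient_div_mul_totient hQ hdQ
    have hmul' : (Nat.totient (Q / d) : ℝ) * Nat.totient d = Nat.totient Q := by exact_mod_cast hmul
    unfold kappa
    rw [eq_div_iff hφd.ne', ← hmul']
    ring
  rw [hdens] at hmt hmA
  -- monotonicity of the mean-value error in `Y`
  set Δ : ℝ := (2 * Q.divisors.card + 7) * (Real.sqrt t * Real.sqrt E + t / E) with hΔ
  have hΔA : (2 * Q.divisors.card + 7) * (Real.sqrt A * Real.sqrt E + A / E) ≤ Δ := by
    rw [hΔ]
    have hAt' : (A : ℝ) ≤ t := by exact_mod_cast hAt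
    have hE0 : (0 : ℝ) < E := by exact_mod_cast hE
    gcongr
  -- assembling
  set P : ℝ := (fam.card : ℝ) with hP
  set W : ℝ := (windowCount q Q d μ ω A t c : ℝ) with hW
  set κd : ℝ := kappa Q G E / Nat.totient d with hκd
  set ρ' : ℝ := (rho (q / d) : ℝ) with hρ'
  have hρ'0 : 0 ≤ ρ' := Nat.cast_nonneg _
  have hP' : P = ρ' * ((rhoSumAP t Q d μ : ℝ) - (rhoSumAP A Q d μ : ℝ)) := hcard
  -- `|Σ(t) − Σ(A) − κd (t − A)| ≤ 2Δ`
  have hdiff : |((rhoSumAP t Q d μ : ℝ) - (rhoSumAP A Q d μ : ℝ)) - κd * ((t : ℝ) - A)| ≤ 2 * Δ := by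
    have e : ((rhoSumAP t Q d μ : ℝ) - (rhoSumAP A Q d μ : ℝ)) - κd * ((t : ℝ) - A) =
        ((rhoSumAP t Q d μ : ℝ) - κd * t) - ((rhoSumAP A Q d μ : ℝ) - κd * A) := by ring
    rw [e]
    refine (abs_sub _ _).trans ?_
    have h1 : |(rhoSumAP t Q d μ : ℝ) - κd * t| ≤ Δ := by rw [hκd]; exact hmt
    have h2 : |(rhoSumAP A Q d μ : ℝ) - κd * A| ≤ Δ := by rw [hκd]; exact hmA.trans hΔA
    linarith
  -- `P ≤ ρ' Σ(t)` (counts are monotone)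
  have hPle : P ≤ ρ' * (rhoSumAP t Q d μ : ℝ) := by
    rw [hP']
    have : (0 : ℝ) ≤ (rhoSumAP A Q d μ : ℝ) := Nat.cast_nonneg _
    nlinarith
  have hP0 : 0 ≤ P := Nat.cast_nonneg _
  rw [← hwin] at h4
  -- combine: `W − (1/q)ρ'κd(t−A) = [W − (1/q)P] + (1/q)ρ'[(Σt−ΣA) − κd(t−A)]`
  have hsplit : W - 1 / q * ρ' * κd * ((t : ℝ) - A) =
      (W - 1 / q * P) + 1 / q * ρ' * (((rhoSumAP t Q d μ : ℝ) - (rhoSumAP A Q d μ : ℝ)) -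
        κd * ((t : ℝ) - A)) := by rw [hP']; ring
  rw [hsplit]
  refine (abs_add_le _ _).trans ?_
  have hterm2 : |1 / q * ρ' * (((rhoSumAP t Q d μ : ℝ) - (rhoSumAP A Q d μ : ℝ)) -
        κd * ((t : ℝ) - A))| ≤ 2 / q * ρ' * Δ := by
    rw [abs_mul, abs_of_nonneg (by positivity : (0 : ℝ) ≤ 1 / q * ρ')]
    calc 1 / q * ρ' * |((rhoSumAP t Q d μ : ℝ) - (rhoSumAP A Q d μ : ℝ)) - κd * ((t : ℝ) - A)|
        ≤ 1 / q * ρ' * (2 * Δ) := mul_le_mul_of_nonneg_left hdiff (by positivity)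
      _ = 2 / q * ρ' * Δ := by ring
  have hterm1 : |W - 1 / q * P| ≤ 4 * ρ' * (rhoSumAP t Q d μ : ℝ) / (A : ℝ) ^ (1 / 4 : ℝ) +
      C * d * (∑ l ∈ Q.divisors, (rho (l * q) : ℝ)) * (1 + Real.log (16 * A)) ^ 2 *
        ((Nat.sqrt (t * q) : ℝ) ^ (1 / 2 + ε) * Nat.sqrt (t * q)) := by
    refine h4.trans ?_
    have hA4 : 0 < (A : ℝ) ^ (1 / 4 : ℝ) := Real.rpow_pos_of_pos hA0 _
    have : 4 * P / (A : ℝ) ^ (1 / 4 : ℝ) ≤ 4 * ρ' * (rhoSumAP t Q d μ : ℝ) / (A : ℝ) ^ (1 / 4 : ℝ) := by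
      refine div_le_div_of_nonneg_right ?_ hA4.le
      linarith
    linarith
  linarith

/-! ### Abel summation in `m` against a decreasing weight -/

/-- **Discrete Abel summation against a linear model**: if `|∑_{A < m ≤ t'} a_m − λ (t' − A)| ≤ E`
for all `A ≤ t' ≤ t`, and `f` is non-increasing and nonnegative on `[A+1, t]`, then
`|∑_{A<m≤t} a_m f(m) − λ ∑_{A<m≤t} f(m)| ≤ E f(A+1)`. [folklore] -/
theorem abs_sum_Ioc_mul_sub_le {a f : ℕ → ℝ} {A t : ℕ} {lam E : ℝ} (hE : 0 ≤ E)
    (ha : ∀ t' : ℕ, A ≤ t' → t' ≤ t → |∑ m ∈ Finset.Ioc A t', a m - lam * ((t' : ℝ) - A)| ≤ E)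
    (hf : ∀ m, A + 1 ≤ m → m < t → f (m + 1) ≤ f m) (hf0 : ∀ m, A + 1 ≤ m → 0 ≤ f m) :
    |∑ m ∈ Finset.Ioc A t, a m * f m - lam * ∑ m ∈ Finset.Ioc A t, f m| ≤ E * f (A + 1) := by
  rcases lt_or_ge t (A + 1) with ht | ht
  · have : Finset.Ioc A t = ∅ := Finset.Ioc_eq_empty (by omega)
    rw [this]; simp
    exact mul_nonneg hE (hf0 _ le_rfl)
  obtain ⟨n, htn⟩ : ∃ n, t = A + n := ⟨t - A, by omega⟩
  -- reindex `m = A + 1 + i`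
  have hIoc : ∀ k : ℕ, Finset.Ioc A (A + k) = (Finset.range k).image (fun i => A + 1 + i) := by
    intro k
    ext m
    simp only [Finset.mem_Ioc, Finset.mem_image, Finset.mem_range]
    constructor
    · rintro ⟨h1, h2⟩; exact ⟨m - (A + 1), by omega, by omega⟩
    · rintro ⟨i, hi, rfl⟩; constructor <;> omega
  have hinj : ∀ k : ℕ, Set.InjOn (fun i => A + 1 + i) (Finset.range k : Set ℕ) :=
    fun k i _ j _ h => by simpa using h
  set c : ℕ → ℝ := fun i => a (A + 1 + i) - lam with hc
  set w : ℕ → ℝ := fun i => f (A + 1 + i) with hw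
  have hmain := abs_sum_mul_le_of_partialSums (c := c) (w := w) n hE ?_ ?_ ?_ ?_
  · have e1 : ∑ i ∈ Finset.range n, w i * c i =
        ∑ m ∈ Finset.Ioc A t, a m * f m - lam * ∑ m ∈ Finset.Ioc A t, f m := by
      rw [htn, hIoc n, Finset.sum_image (hinj n), Finset.sum_image (hinj n), Finset.mul_sum,
        ← Finset.sum_sub_distrib]
      refine Finset.sum_congr rfl fun i _ => ?_
      simp only [hw, hc]; ring
    rw [← e1]
    simpa [hw] using hmain
  · intro i hi
    have e : ∑ j ∈ Finset.range i, c j = ∑ m ∈ Finset.Ioc A (A + i), a m - lam * (((A + i : ℕ) : ℝ) - A) := by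
      rw [hIoc i, Finset.sum_image (hinj i)]
      simp only [hc]
      rw [Finset.sum_sub_distrib, Finset.sum_const, Finset.card_range, nsmul_eq_mul]
      push_cast; ring
    rw [e]
    exact ha (A + i) (by omega) (by omega)
  · intro i hi
    simp only [hw]
    rw [show A + 1 + (i + 1) = A + 1 + i + 1 by ring]
    exact hf _ (by omega) (by omega)
  · simp only [hw]; exact hf0 _ (by omega)
  · intro i hi; simp only [hw]; exact hf0 _ (by omega)

/-! ### The window counts fibrewise in `m`, and the weighted version of the linear model -/

/-- The fibre of the window count at `m`: `a(m) = [(m,Q)=1, m ≡ μ (d)] · #{Θ root mod mq :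
Θ ≡ ω (d), ⌊Θ/m⌋ = c}`. [cite: IwaniecInventiones1978, Lemma 4] -/
def windowFibre (q Q d μ ω c m : ℕ) : ℕ :=
  if m.Coprime Q ∧ m ≡ μ [MOD d] then
    ((rootsNat (m * q)).filter (fun Θ => Θ ≡ ω [MOD d] ∧ Θ / m = c)).card else 0

/-- A weighted window sum over the family is the `m`-sum of the fibres. [folklore] -/
theorem sum_window_family_eq (q Q d μ ω A t c : ℕ) (g : ℕ → ℝ) :
    ∑ p ∈ (lemma4Family q Q d μ ω A t).filter (fun p : ℕ × ℕ => p.2 / p.1 = c), g p.1 =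
      ∑ m ∈ Finset.Ioc A t, (windowFibre q Q d μ ω c m : ℝ) * g m := by
  classical
  set fam := (lemma4Family q Q d μ ω A t).filter (fun p : ℕ × ℕ => p.2 / p.1 = c) with hfam
  have hmaps : ∀ p ∈ fam, p.1 ∈ Finset.Ioc A t := by
    intro p hp
    rw [hfam, Finset.mem_filter, mem_lemma4Family] at hp
    rw [Finset.mem_Ioc]; exact hp.1.1
  rw [← Finset.sum_fiberwise_of_maps_to hmaps]
  refine Finset.sum_congr rfl fun m hm => ?_
  rw [Finset.mem_Ioc] at hm
  have hconst : ∀ p ∈ fam.filter (fun p : ℕ × ℕ => p.1 = m), g p.1 = g m := by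
    intro p hp; rw [Finset.mem_filter] at hp; rw [hp.2]
  rw [Finset.sum_congr rfl hconst, Finset.sum_const, nsmul_eq_mul]
  congr 1
  unfold windowFibre
  by_cases hcond : m.Coprime Q ∧ m ≡ μ [MOD d]
  · rw [if_pos hcond]
    norm_cast
    refine Finset.card_bij (fun p _ => p.2) ?_ ?_ ?_
    · intro p hp
      rw [Finset.mem_filter, hfam, Finset.mem_filter, mem_lemma4Family] at hp
      obtain ⟨⟨⟨-, -, -, h4, h5⟩, hwin⟩, rfl⟩ := hp
      exact Finset.mem_filter.mpr ⟨h4, h5, hwin⟩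
    · intro a ha b hb hab
      rw [Finset.mem_filter] at ha hb
      exact Prod.ext (ha.2.trans hb.2.symm) hab
    · intro Θ hΘ
      rw [Finset.mem_filter] at hΘ
      refine ⟨(m, Θ), ?_, rfl⟩
      rw [Finset.mem_filter, hfam, Finset.mem_filter, mem_lemma4Family]
      exact ⟨⟨⟨hm, hcond.1, hcond.2, hΘ.1, hΘ.2.1⟩, hΘ.2.2⟩, rfl⟩
  · rw [if_neg hcond]
    norm_cast
    rw [Finset.card_eq_zero, Finset.filter_eq_empty_iff]
    intro p hp hpm
    rw [hfam, Finset.mem_filter, mem_lemma4Family] at hp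
    rw [hpm] at hp
    exact hcond ⟨hp.1.2.1, hp.1.2.2.1⟩

/-- The window count as the `m`-sum of its fibres. [folklore] -/
theorem windowCount_eq_sum_windowFibre (q Q d μ ω A t c : ℕ) :
    (windowCount q Q d μ ω A t c : ℝ) = ∑ m ∈ Finset.Ioc A t, (windowFibre q Q d μ ω c m : ℝ) := by
  unfold windowCount
  rw [Finset.card_eq_sum_ones, Nat.cast_sum]
  push_cast
  have := sum_window_family_eq q Q d μ ω A t c (fun _ => (1 : ℝ))
  simp only [mul_one] at this
  rw [← this]

/-- The error term of the linear model, as a function of the data (monotone in `t`).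
[cite: IwaniecInventiones1978, Lemma 4] -/
def windowErr (C ε : ℝ) (q Q d μ A t E : ℕ) : ℝ :=
  4 * (rho (q / d) : ℝ) * (rhoSumAP t Q d μ : ℝ) / (A : ℝ) ^ (1 / 4 : ℝ) +
    C * d * (∑ l ∈ Q.divisors, (rho (l * q) : ℝ)) * (1 + Real.log (16 * A)) ^ 2 *
      ((Nat.sqrt (t * q) : ℝ) ^ (1 / 2 + ε) * Nat.sqrt (t * q)) +
    2 / q * (rho (q / d) : ℝ) * ((2 * Q.divisors.card + 7) * (Real.sqrt t * Real.sqrt E + t / E))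

/-- `rhoSumAP` is monotone in its length. [folklore] -/
theorem rhoSumAP_mono {Y Y' : ℕ} (h : Y ≤ Y') (Q d μ : ℕ) : rhoSumAP Y Q d μ ≤ rhoSumAP Y' Q d μ := by
  unfold rhoSumAP
  refine Finset.sum_le_sum_of_subset_of_nonneg ?_ fun _ _ _ => Nat.zero_le _
  exact Finset.filter_subset_filter _ (Finset.Ioc_subset_Ioc_right h)

/-- `windowErr` is monotone in `t` (for `C ≥ 0`, `E ≥ 1`, `ε ≥ 0`). [folklore] -/
theorem windowErr_mono {C ε : ℝ} (hC : 0 ≤ C) (hε : 0 ≤ ε) {q Q d μ A t t' E : ℕ}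
    (hE : 1 ≤ E) (htt' : t ≤ t') : windowErr C ε q Q d μ A t E ≤ windowErr C ε q Q d μ A t' E := by
  unfold windowErr
  have h1 : (rhoSumAP t Q d μ : ℝ) ≤ rhoSumAP t' Q d μ := by exact_mod_cast rhoSumAP_mono htt' Q d μ
  have h2 : (Nat.sqrt (t * q) : ℝ) ≤ Nat.sqrt (t' * q) := by
    exact_mod_cast Nat.sqrt_le_sqrt (Nat.mul_le_mul_right q htt')
  have h3 : (Nat.sqrt (t * q) : ℝ) ^ (1 / 2 + ε) ≤ (Nat.sqrt (t' * q) : ℝ) ^ (1 / 2 + ε) :=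
    Real.rpow_le_rpow (Nat.cast_nonneg _) h2 (by linarith)
  have h4 : Real.sqrt t ≤ Real.sqrt t' := Real.sqrt_le_sqrt (by exact_mod_cast htt')
  have h5 : (t : ℝ) / E ≤ (t' : ℝ) / E :=
    div_le_div_of_nonneg_right (by exact_mod_cast htt') (by positivity)
  have hA : 0 ≤ (A : ℝ) ^ (1 / 4 : ℝ) := Real.rpow_nonneg (Nat.cast_nonneg _) _
  gcongr

/-- **The weighted linear model**: with the data of `windowCount_linear` and `t ≤ t₁`,
`|∑_{(m,Θ) ∈ window c} 1/m − (1/q) ρ(q/d)(κ/φ(d)) ∑_{A<m≤t} 1/m| ≤ windowErr(t₁)/(A+1)`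
(Abel summation in `m`; the linear-model error is monotone in `t`).
[cite: IwaniecInventiones1978, §4 p. 182] -/
theorem windowSum_inv_linear (h6 : lemma6_hooley) {ε : ℝ} (hε : 0 < ε) :
    ∃ C : ℝ, 0 ≤ C ∧ ∀ (q Q d μ ω A t c E G : ℕ), Squarefree Q → q ∣ Q → d ∣ q → d % 2 = 1 →
      μ.Coprime d → d ∣ ω ^ 2 + 1 → 2 ≤ A → A ≤ t → c < q → 1 ≤ E → E ≤ A → Nat.sqrt t ≤ G →
      (|(windowCount q Q d μ ω A t c : ℝ) -
          1 / q * (rho (q / d) : ℝ) * (kappa Q G E / Nat.totient d) * ((t : ℝ) - A)| ≤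
        windowErr C ε q Q d μ A t E) ∧
      |∑ p ∈ (lemma4Family q Q d μ ω A t).filter (fun p : ℕ × ℕ => p.2 / p.1 = c), (1 : ℝ) / p.1 -
          1 / q * (rho (q / d) : ℝ) * (kappa Q G E / Nat.totient d) *
            ∑ m ∈ Finset.Ioc A t, (1 : ℝ) / m| ≤
        windowErr C ε q Q d μ A t E / (A + 1) := by
  obtain ⟨C, hC0, hC⟩ := windowCount_linear h6 hε
  refine ⟨C, hC0, ?_⟩
  intro q Q d μ ω A t c E G hQ hqQ hdq hd2 hμ hω hA hAt hcq hE hEA hG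
  have hmain : ∀ t' : ℕ, A ≤ t' → t' ≤ t →
      |(windowCount q Q d μ ω A t' c : ℝ) -
          1 / q * (rho (q / d) : ℝ) * (kappa Q G E / Nat.totient d) * ((t' : ℝ) - A)| ≤
        windowErr C ε q Q d μ A t E := by
    intro t' hAt' ht't
    have h := hC q Q d μ ω A t' c E G hQ hqQ hdq hd2 hμ hω hA hAt' hcq hE hEA
      ((Nat.sqrt_le_sqrt ht't).trans hG)
    exact h.trans (windowErr_mono hC0 hε.le hE ht't)
  refine ⟨hmain t hAt le_rfl, ?_⟩
  -- Abel in `m`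
  set lam : ℝ := 1 / q * (rho (q / d) : ℝ) * (kappa Q G E / Nat.totient d) with hlam
  have hws := sum_window_family_eq q Q d μ ω A t c (fun m => (1 : ℝ) / m)
  rw [hws]
  have hErr0 : 0 ≤ windowErr C ε q Q d μ A t E := (abs_nonneg _).trans (hmain A le_rfl hAt)
  have habel := abs_sum_Ioc_mul_sub_le (a := fun m => (windowFibre q Q d μ ω c m : ℝ))
    (f := fun m => (1 : ℝ) / m) (lam := lam) (A := A) (t := t) hErr0 ?_ ?_ ?_
  · have e : windowErr C ε q Q d μ A t E * (1 / ((A + 1 : ℕ) : ℝ)) =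
        windowErr C ε q Q d μ A t E / (A + 1) := by push_cast; ring
    rw [e] at habel
    exact habel
  · intro t' hAt' ht't
    rw [← windowCount_eq_sum_windowFibre]
    exact hmain t' hAt' ht't
  · intro m hm _
    have hm0 : (0 : ℝ) < m := by exact_mod_cast (by omega : 0 < m)
    gcongr
    norm_num
  · intro m hm
    positivity

/-! ### The evaluation of `U` -/

/-- **`U = ∑_{(m,Q)=1} ρ(m)/m²` against its linear model**: for `Q` squarefree, `A ≤ B`,
`1 ≤ E ≤ A` (`A ≥ 1`) and `⌊√B⌋ ≤ G`,
`|∑_{A<m≤B, (m,Q)=1} ρ(m)/m² − κ ∑_{A<m≤B} 1/m²| ≤ 2(2τ(Q)+7)(√B √E + B/E)/(A+1)²`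
(Abel summation of the mean value of `ρ`, `abs_rhoSumAP_sub_le` with `d = 1`).
[cite: IwaniecInventiones1978, §4 p. 181] -/
theorem usum_linear {Q A B E G : ℕ} (hQ : Squarefree Q) (hAB : A ≤ B) (hE : 1 ≤ E) (hEA : E ≤ A)
    (hG : Nat.sqrt B ≤ G) :
    |∑ m ∈ (Finset.Ioc A B).filter (fun m : ℕ => m.Coprime Q), (rho m : ℝ) / (m : ℝ) ^ 2 -
        kappa Q G E * ∑ m ∈ Finset.Ioc A B, (1 : ℝ) / (m : ℝ) ^ 2| ≤
      2 * ((2 * Q.divisors.card + 7) * (Real.sqrt B * Real.sqrt E + B / E)) / ((A : ℝ) + 1) ^ 2 := by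
  set Δ : ℝ := (2 * Q.divisors.card + 7) * (Real.sqrt B * Real.sqrt E + B / E) with hΔ
  have hΔ0 : 0 ≤ Δ := by rw [hΔ]; positivity
  have hE0 : (0 : ℝ) < E := by exact_mod_cast hE
  -- the indicator-weighted sequence and its partial sums
  set a : ℕ → ℝ := fun m => if m.Coprime Q then (rho m : ℝ) else 0 with ha
  have hfil : ∀ Y : ℕ, (rhoSumAP Y Q 1 0 : ℝ) = ∑ m ∈ Finset.Ioc 0 Y, a m := by
    intro Y
    unfold rhoSumAP
    rw [Nat.cast_sum, Finset.sum_filter]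
    refine Finset.sum_congr rfl fun m _ => ?_
    have h1 : m ≡ 0 [MOD 1] := Nat.modEq_one
    by_cases h : m.Coprime Q
    · rw [if_pos ⟨h, h1⟩, ha]; simp only [if_pos h]
    · rw [if_neg (fun h' => h h'.1), ha]; simp only [if_neg h]
  have hpartial : ∀ t' : ℕ, A ≤ t' →
      ∑ m ∈ Finset.Ioc A t', a m = (rhoSumAP t' Q 1 0 : ℝ) - (rhoSumAP A Q 1 0 : ℝ) := by
    intro t' hAt'
    have hsplit : Finset.Ioc 0 t' = Finset.Ioc 0 A ∪ Finset.Ioc A t' :=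
      (Finset.Ioc_union_Ioc_eq_Ioc (Nat.zero_le A) hAt').symm
    have hdisj : Disjoint (Finset.Ioc 0 A) (Finset.Ioc A t') :=
      Finset.disjoint_left.mpr fun x hx hx' => by rw [Finset.mem_Ioc] at hx hx'; omega
    rw [hfil, hfil, hsplit, Finset.sum_union hdisj]
    ring
  -- the mean value with `d = 1`, `μ = 0`
  have hmv : ∀ Y : ℕ, E ≤ Y → Nat.sqrt Y ≤ G →
      |(rhoSumAP Y Q 1 0 : ℝ) - kappa Q G E * Y| ≤
        (2 * Q.divisors.card + 7) * (Real.sqrt Y * Real.sqrt E + Y / E) := by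
    intro Y hEY hGY
    have h := abs_rhoSumAP_sub_le (Q := Q) (d := 1) (μ := 0) hQ (one_dvd Q) (by norm_num)
      (Nat.coprime_one_right 0) hE hEY hGY
    rw [Nat.div_one] at h
    unfold kappa
    exact h
  -- the linear model for the partial sums, error `2Δ`
  have hlin : ∀ t' : ℕ, A ≤ t' → t' ≤ B →
      |∑ m ∈ Finset.Ioc A t', a m - kappa Q G E * ((t' : ℝ) - A)| ≤ 2 * Δ := by
    intro t' hAt' ht'B
    rw [hpartial t' hAt']
    have h1 := hmv t' (hEA.trans hAt') ((Nat.sqrt_le_sqrt ht'B).trans hG)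
    have h2 := hmv A hEA ((Nat.sqrt_le_sqrt hAB).trans hG)
    have hmono : ∀ Y : ℕ, Y ≤ B →
        (2 * Q.divisors.card + 7) * (Real.sqrt Y * Real.sqrt E + Y / E) ≤ Δ := by
      intro Y hY
      rw [hΔ]
      have hY' : (Y : ℝ) ≤ B := by exact_mod_cast hY
      gcongr
    have e : ((rhoSumAP t' Q 1 0 : ℝ) - (rhoSumAP A Q 1 0 : ℝ)) - kappa Q G E * ((t' : ℝ) - A) =
        ((rhoSumAP t' Q 1 0 : ℝ) - kappa Q G E * t') - ((rhoSumAP A Q 1 0 : ℝ) - kappa Q G E * A) := by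
      ring
    rw [e]
    refine (abs_sub _ _).trans ?_
    linarith [hmono t' ht'B, hmono A hAB]
  -- Abel summation with `f(m) = 1/m²`
  have habel := abs_sum_Ioc_mul_sub_le (a := a) (f := fun m => (1 : ℝ) / (m : ℝ) ^ 2)
    (lam := kappa Q G E) (A := A) (t := B) (E := 2 * Δ) (by positivity) hlin ?_ ?_
  · have hlhs : ∑ m ∈ (Finset.Ioc A B).filter (fun m : ℕ => m.Coprime Q), (rho m : ℝ) / (m : ℝ) ^ 2 =
        ∑ m ∈ Finset.Ioc A B, a m * (1 / (m : ℝ) ^ 2) := by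
      rw [Finset.sum_filter]
      refine Finset.sum_congr rfl fun m _ => ?_
      by_cases h : m.Coprime Q
      · simp only [ha, if_pos h]; ring
      · simp only [ha, if_neg h]; ring
    rw [hlhs]
    refine habel.trans (le_of_eq ?_)
    push_cast
    ring
  · intro m hm _
    have hm0 : (0 : ℝ) < m := by exact_mod_cast (by omega : 0 < m)
    gcongr
    norm_num
  · intro m hm
    positivity

end Literature.NumberTheory.Sieve.Iwaniec1978

end
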